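import Summits.HodgeConjecture.HodgeConjecture.Theses.HeckePrymWeil
import Literature.AlgebraicGeometry.HodgeTheory.GysinFormalismCorrespondences

/-!
# Route HeckePrymWeil — `IsoInvariance` (item stmt-HodgeConjecture-1078)

Algebraic classes — and more generally the whole support filtration `Nᶜ Hᵃ(–(ℂ); ℂ)` of
`Literature.AlgebraicGeometry.HodgeTheory.supportedClasses` — are transported by isomorphisms of
`ℂ`-schemes: for `e : X ≅ Y` in `Over (Spec ℂ)`, `e^*(Nᶜ Hᵃ(Y)) ⊆ Nᶜ Hᵃ(X)`, in particular
`e^*(algebraicClasses Y p) ⊆ algebraicClasses X p`.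

Proof (functoriality bookkeeping, Fulton 1998 §19.1 / Grothendieck 1969 §1): a generator of
`Nᶜ Hᵃ(Y)` is a class dying on `(Y ∖ Z)(ℂ)` for a Zariski-closed `Z ⊆ Y` all of whose points have
codimension `≥ c`; its pull-back dies on `(X ∖ e⁻¹Z)(ℂ)`
(`complexBetti.restrictCompl_map_eq_zero`), `e⁻¹Z` is closed, and every point of `e⁻¹Z` has the
same codimension as its image because `e.hom.left` is an isomorphism of schemes, hence an open
immersion, and open immersions preserve `Order.coheight`
(`AlgebraicGeometry.coheight_eq_of_isOpenImmersion`).  In fact only `IsOpenImmersion f.left` is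
used, so the lemma is stated for an arbitrary `ℂ`-morphism whose underlying scheme morphism is an
open immersion, with NO Noetherian / smoothness hypotheses (the tree's
`map_mem_supportedClasses_of_flat` needs locally Noetherian schemes to control codimension along a
flat map; for open immersions codimension is preserved outright).
-/

noncomputable section

open CategoryTheory AlgebraicGeometry
open Literature.AlgebraicGeometry Literature.AlgebraicGeometry.HodgeTheory

namespace Summit.HodgeConjecture.HodgeConjecture.Theorems

/-- **Pull-back along a `ℂ`-morphism that is an open immersion of schemes respects the support
filtration**, with no finiteness hypotheses: for `f : X ⟶ Y` over `ℂ` with `f.left` an open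
immersion, `f^*(Nᶜ Hᵃ(Y(ℂ); ℂ)) ⊆ Nᶜ Hᵃ(X(ℂ); ℂ)`.  A class dying off a closed `Z ⊆ Y` of
codimension `≥ c` pulls back to a class dying off the closed `f⁻¹Z`, whose points `x` satisfy
`codim x = codim f(x) ≥ c` (`coheight_eq_of_isOpenImmersion`).
[cite: GrothendieckTopology1969, §1] -/
theorem map_mem_supportedClasses_of_isOpenImmersion_left {X Y : Motives.SchemeOver ℂ} (f : X ⟶ Y)
    [IsOpenImmersion f.left] {a c : ℕ} {y : complexBetti Y a} (hy : y ∈ supportedClasses Y a c) :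
    complexBetti.map f a y ∈ supportedClasses X a c := by
  suffices h : supportedClasses Y a c ≤
      (supportedClasses X a c).comap (complexBetti.map f a).hom from h hy
  refine iSup_le fun S ↦ iSup_le fun hS ↦ iSup_le fun hc ↦ fun z hz ↦ ?_
  rw [LinearMap.mem_ker] at hz
  refine mem_supportedClasses_of_restrictCompl_eq_zero (hS.preimage f.left.base.hom.continuous)
    (fun w hw ↦ (hc _ hw).trans (coheight_eq_of_isOpenImmersion f.left).le) ?_
  exact complexBetti.restrictCompl_map_eq_zero f hz

/-- **Isomorphisms of `ℂ`-schemes transport the support filtration**: for `e : X ≅ Y` in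
`Over (Spec ℂ)`, `e^*(Nᶜ Hᵃ(Y(ℂ); ℂ)) ⊆ Nᶜ Hᵃ(X(ℂ); ℂ)` (an isomorphism is an open immersion).
[cite: GrothendieckTopology1969, §1] -/
theorem map_mem_supportedClasses_of_iso {X Y : Motives.SchemeOver ℂ} (e : X ≅ Y) {a c : ℕ}
    {y : complexBetti Y a} (hy : y ∈ supportedClasses Y a c) :
    complexBetti.map e.hom a y ∈ supportedClasses X a c :=
  map_mem_supportedClasses_of_isOpenImmersion_left e.hom hy

/-- **Isomorphisms of `ℂ`-schemes transport algebraic classes**: for `e : X ≅ Y`,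
`e^*(algebraicClasses Y p) ⊆ algebraicClasses X p` — the case `Nᵖ H²ᵖ` of
`map_mem_supportedClasses_of_iso` (Fulton: `e^* cl(Z) = cl(e⁻¹ Z)` for an isomorphism `e`).
[cite: Fulton1998, §19.1] -/
theorem map_mem_algebraicClasses_of_iso {X Y : Motives.SchemeOver ℂ} (e : X ≅ Y) {p : ℕ}
    {y : complexBetti Y (2 * p)} (hy : y ∈ algebraicClasses Y p) :
    complexBetti.map e.hom (2 * p) y ∈ algebraicClasses X p :=
  map_mem_supportedClasses_of_iso e hy

/-- **Item stmt-HodgeConjecture-1078 (`IsoInvariance`, support of route HeckePrymWeil)**: algebraic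
classes are transported by isomorphisms of `ℂ`-schemes — for `e : X ≅ Y`, `p : ℕ` and
`c ∈ algebraicClasses Y p`, `e^* c ∈ algebraicClasses X p`.  The type is literally the route decl
`Summit.HodgeConjecture.HodgeConjecture.Theses.HeckePrymWeil.IsoInvariance`.
[cite: Fulton1998, §19.1] -/
theorem isoInvariance_proof :
    Summit.HodgeConjecture.HodgeConjecture.Theses.HeckePrymWeil.IsoInvariance := by
  unfold Summit.HodgeConjecture.HodgeConjecture.Theses.HeckePrymWeil.IsoInvariance
  intro X Y e p c hc
  exact map_mem_algebraicClasses_of_iso e hc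

end Summit.HodgeConjecture.HodgeConjecture.Theorems

end
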